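import Mathlib
import Summits.ValiantsHypothesis.ValiantsHypothesis.Theorems.ProofCarryingSymmetryRestorationQPACComb

/-!
# Route ProofCarryingSymmetry — crux `RestorationQP`, line `registered`: laying a labelled circuit out as a straight-line circuit

B-core″, part 3b.  Given a Dawar–Wilsenach labelled circuit `D` on a finite gate type `G` and a
numbering `f : G → ℕ` increasing along wires, we lay `D` out as the body of a Hrubeš–Tzameret
straight-line circuit (`PICircuit`): position `p` owns the BLOCK of `bl = |G| + 2` consecutive
nodes `p·bl, …, p·bl + bl - 1`; the block of the gate `g` with `f g = p` ends (index `bl - 1`)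
with a node computing `g` — a leaf for an input gate, `t × 1` for a fan-in-one gate, and otherwise
the left comb `((t₀ ∘ t₁) ∘ t₂) ∘ ⋯` of the outputs of the children (enumerated by `Finset.toList`,
as in `binTree`), laid out in the last `r - 1` slots of the block; unused slots and unowned blocks
hold the junk leaf `0`.

Main result `getD_unfoldList_layoutBody`: the node at index `i` UNFOLDS to the intended formula
`valAt i`; in particular the last node of the block of `g` unfolds to `binTree D g`
(`unfold_layout_outPos`).  Part 3c turns this into a `PICircuit` for the output gate whose renamed
unfoldings are AC-invariant when `D` is symmetric.  Everything proved; no named facts.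
-/

-- single-problem summit: `Summit.ValiantsHypothesis.ValiantsHypothesis.…` is the namespace by design (D-0017)
set_option linter.dupNamespace false

noncomputable section

open scoped Classical

namespace Summit.ValiantsHypothesis.ValiantsHypothesis.Theorems

namespace ACStability

open Literature.Computability.AlgebraicComplexity PICircuit

universe u v

variable {𝔽 : Type u} [Zero 𝔽] [One 𝔽] {X : Type v} {Yo : Type*} {G : Type*} [Fintype G]
variable (D : LabelledArithCircuit 𝔽 X Yo G) (f : G → ℕ)

/-! ### The layout -/

/-- Block length: room for a comb over at most `|G|` children, or for `t × 1`. [folklore] -/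
def bl : ℕ := Fintype.card G + 2

/-- The index of the output node of the block of `g`. [folklore] -/
def outPos (g : G) : ℕ := f g * bl (G := G) + (bl (G := G) - 1)

/-- The output indices of the children of `g`, in enumeration order. [folklore] -/
def kidPos (g : G) : List ℕ := (D.children g).toList.map (outPos f)

/-- The binarised formulas of the children of `g`, in enumeration order. [folklore] -/
def kidTrees (g : G) : List (PIFormula 𝔽 X) := (D.children g).toList.map (binTree D)

/-- Node `j` of the block of an internal gate `g` (operation node constructor `mk`): for one child,
`const 1` at `bl - 2` and `child × 1` at `bl - 1`; for `r ≥ 2` children, the comb nodes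
`k = j + r - bl ∈ [1, r-1]` at `j ∈ [bl - r + 1, bl - 1]`. [folklore] -/
def combNode (mk : ℕ → ℕ → Node 𝔽 X) (g : G) (j : ℕ) : Node 𝔽 X :=
  if (kidPos D f g).length = 1 then
    (if j = bl (G := G) - 1 then .mul ((kidPos D f g).getD 0 0) (f g * bl (G := G) + (bl (G := G) - 2))
      else if j = bl (G := G) - 2 then .const 1 else .const 0)
  else if bl (G := G) + 1 ≤ j + (kidPos D f g).length ∧ j + 1 ≤ bl (G := G) then
    (if j + (kidPos D f g).length = bl (G := G) + 1 then mk ((kidPos D f g).getD 0 0) ((kidPos D f g).getD 1 0)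
      else mk (f g * bl (G := G) + j - 1) ((kidPos D f g).getD (j + (kidPos D f g).length - bl (G := G)) 0))
  else .const 0

/-- Node `j` of the block of the gate `g`. [folklore] -/
def blockNode (g : G) (j : ℕ) : Node 𝔽 X :=
  match D.label g with
  | .var x => if j = bl (G := G) - 1 then .var x else .const 0
  | .const c => if j = bl (G := G) - 1 then .const c else .const 0
  | .add => combNode D f .add g j
  | .mul => combNode D f .mul g j

/-- The node at absolute index `i`: node `i % bl` of the block owned by the gate numbered
`i / bl`, junk `0` if none. [folklore] -/
def nodeAt (i : ℕ) : Node 𝔽 X :=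
  if h : ∃ g, f g = i / bl (G := G) then blockNode D f (Classical.choose h) (i % bl (G := G)) else .const 0

/-- The straight-line body of the layout, of length `P · bl`. [folklore] -/
def layoutBody (P : ℕ) : List (Node 𝔽 X) := List.ofFn fun i : Fin (P * bl (G := G)) => nodeAt D f i.1

/-! ### The intended unfoldings -/

/-- The intended unfolding of node `j` of the block of an internal gate (formula operation `op`).
[folklore] -/
def combTree (op : PIFormula 𝔽 X → PIFormula 𝔽 X → PIFormula 𝔽 X) (g : G) (j : ℕ) : PIFormula 𝔽 X :=
  if (kidTrees D g).length = 1 then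
    (if j = bl (G := G) - 1 then combGate op (kidTrees D g)
      else if j = bl (G := G) - 2 then .const 1 else .const 0)
  else if bl (G := G) + 1 ≤ j + (kidTrees D g).length ∧ j + 1 ≤ bl (G := G) then
    combGate op ((kidTrees D g).take (j + (kidTrees D g).length - bl (G := G) + 1))
  else .const 0

/-- The intended unfolding of node `j` of the block of `g`. [folklore] -/
def blockTree (g : G) (j : ℕ) : PIFormula 𝔽 X :=
  match D.label g with
  | .var x => if j = bl (G := G) - 1 then .var x else .const 0
  | .const c => if j = bl (G := G) - 1 then .const c else .const 0
  | .add => combTree D .add g j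
  | .mul => combTree D .mul g j

/-- The intended unfolding of the node at absolute index `i`. [folklore] -/
def valAt (i : ℕ) : PIFormula 𝔽 X :=
  if h : ∃ g, f g = i / bl (G := G) then blockTree D (Classical.choose h) (i % bl (G := G)) else .const 0

/-! ### Bookkeeping lemmas -/

variable {D f}

omit [Zero 𝔽] [One 𝔽] in
/-- `2 ≤ bl`. [folklore] -/
theorem two_le_bl : 2 ≤ bl (G := G) := Nat.le_add_left 2 _

omit [Zero 𝔽] [One 𝔽] in
/-- Lengths of `kidPos` and `kidTrees` agree. [folklore] -/
theorem length_kidPos (g : G) : (kidPos D f g).length = (D.children g).toList.length := by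
  simp [kidPos]

omit [Fintype G] in
/-- Lengths of `kidPos` and `kidTrees` agree. [folklore] -/
theorem length_kidTrees (g : G) : (kidTrees D g).length = (D.children g).toList.length := by
  simp [kidTrees]

omit [Zero 𝔽] [One 𝔽] in
/-- Fan-in is at most `|G|`, hence `< bl - 1`. [folklore] -/
theorem length_toList_children_le (g : G) : (D.children g).toList.length ≤ Fintype.card G := by
  rw [Finset.length_toList]; exact Finset.card_le_univ _

omit [Zero 𝔽] [One 𝔽] [Fintype G] in
/-- An internal gate has at least one child. [folklore] -/
theorem one_le_length_toList_children {g : G} (h : ¬ (D.label g).IsInput) :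
    1 ≤ (D.children g).toList.length := by
  rw [Finset.length_toList, Nat.one_le_iff_ne_zero, Ne, Finset.card_eq_zero]
  exact fun he => h ((D.isInput_iff g).2 he)

omit [Zero 𝔽] [One 𝔽] in
/-- Division of an in-block index. [folklore] -/
theorem div_of_block (p j : ℕ) (hj : j < bl (G := G)) : (p * bl (G := G) + j) / bl (G := G) = p := by
  have hb : 0 < bl (G := G) := lt_of_lt_of_le (by norm_num) two_le_bl
  rw [Nat.add_comm, Nat.add_mul_div_right _ _ hb, Nat.div_eq_of_lt hj, Nat.zero_add]

omit [Zero 𝔽] [One 𝔽] in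
/-- Remainder of an in-block index. [folklore] -/
theorem mod_of_block (p j : ℕ) (hj : j < bl (G := G)) : (p * bl (G := G) + j) % bl (G := G) = j := by
  rw [Nat.add_comm, Nat.add_mul_mod_self_right, Nat.mod_eq_of_lt hj]

/-- `valAt` inside the block of `g`. [folklore] -/
theorem valAt_block (hf : Function.Injective f) (g : G) {j : ℕ} (hj : j < bl (G := G)) :
    valAt D f (f g * bl (G := G) + j) = blockTree D g j := by
  have hex : ∃ g', f g' = (f g * bl (G := G) + j) / bl (G := G) := ⟨g, (div_of_block _ _ hj).symm⟩
  rw [valAt, dif_pos hex, mod_of_block _ _ hj]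
  congr 1
  exact hf ((Classical.choose_spec hex).trans (div_of_block _ _ hj))

/-- `nodeAt` inside the block of `g`. [folklore] -/
theorem nodeAt_block (hf : Function.Injective f) (g : G) {j : ℕ} (hj : j < bl (G := G)) :
    nodeAt D f (f g * bl (G := G) + j) = blockNode D f g j := by
  have hex : ∃ g', f g' = (f g * bl (G := G) + j) / bl (G := G) := ⟨g, (div_of_block _ _ hj).symm⟩
  rw [nodeAt, dif_pos hex, mod_of_block _ _ hj]
  congr 1
  exact hf ((Classical.choose_spec hex).trans (div_of_block _ _ hj))

/-- The last node of the block of `g` is meant to unfold to `binTree D g`. [folklore] -/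
theorem blockTree_last (g : G) : blockTree D g (bl (G := G) - 1) = binTree D g := by
  have hb := two_le_bl (G := G)
  unfold blockTree
  rcases hl : D.label g with x | c | _ | _
  · simp only [↓reduceIte]; rw [binTree_of_var D hl]
  · simp only [↓reduceIte]; rw [binTree_of_const D hl]
  · have hr : 1 ≤ (kidTrees D g).length := by
      rw [length_kidTrees]; exact one_le_length_toList_children (by simp [hl, CircuitLabel.IsInput])
    have hr' : (kidTrees D g).length ≤ Fintype.card G := by
      rw [length_kidTrees]; exact length_toList_children_le g
    simp only [combTree]
    rw [binTree_of_add D hl]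
    split_ifs with h1 h2
    · rfl
    · rw [show bl (G := G) - 1 + (kidTrees D g).length - bl (G := G) + 1 = (kidTrees D g).length by
        unfold bl at *; omega, List.take_length]; rfl
    · exfalso; unfold bl at *; omega
  · have hr : 1 ≤ (kidTrees D g).length := by
      rw [length_kidTrees]; exact one_le_length_toList_children (by simp [hl, CircuitLabel.IsInput])
    have hr' : (kidTrees D g).length ≤ Fintype.card G := by
      rw [length_kidTrees]; exact length_toList_children_le g
    simp only [combTree]
    rw [binTree_of_mul D hl]
    split_ifs with h1 h2
    · rfl
    · rw [show bl (G := G) - 1 + (kidTrees D g).length - bl (G := G) + 1 = (kidTrees D g).length by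
        unfold bl at *; omega, List.take_length]; rfl
    · exfalso; unfold bl at *; omega

/-- The output node of `h` is meant to unfold to `binTree D h`. [folklore] -/
theorem valAt_outPos (hf : Function.Injective f) (h : G) : valAt D f (outPos f h) = binTree D h := by
  have hb := two_le_bl (G := G)
  rw [outPos, valAt_block hf h (by omega), blockTree_last]

/-! ### Combs, one node at a time -/

/-- `combGate` on the first two children. [folklore] -/
theorem combGate_take_two (op : PIFormula 𝔽 X → PIFormula 𝔽 X → PIFormula 𝔽 X) {ts : List (PIFormula 𝔽 X)}
    (h : 2 ≤ ts.length) : combGate op (ts.take 2) = op (ts.getD 0 (.const 0)) (ts.getD 1 (.const 0)) := by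
  match ts, h with
  | t₀ :: t₁ :: l, _ => simp [combGate]

/-- `combGate` one child further. [folklore] -/
theorem combGate_take_succ (op : PIFormula 𝔽 X → PIFormula 𝔽 X → PIFormula 𝔽 X) {ts : List (PIFormula 𝔽 X)}
    {k : ℕ} (hk : 2 ≤ k) (hkl : k < ts.length) :
    combGate op (ts.take (k + 1)) = op (combGate op (ts.take k)) (ts.getD k (.const 0)) := by
  match ts, k, hk with
  | _, 0, hk => exact absurd hk (by norm_num)
  | _, 1, hk => exact absurd hk (by norm_num)
  | [], k + 2, _ => simp at hkl
  | [t], k + 2, _ => simp at hkl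
  | t₀ :: t₁ :: l, k + 2, _ =>
    simp only [List.length_cons] at hkl
    have hk' : k < l.length := by omega
    simp only [combGate, List.take_succ_cons, List.getD_cons_succ]
    rw [List.take_succ_eq_append_getElem hk', List.foldl_concat, List.getD_eq_getElem _ _ hk']

end ACStability

open Literature.Computability.AlgebraicComplexity in
/-- **The last node of a gate's block is meant to unfold to the gate's binarised formula**
(registered helper toward the converse of S3″ / honesty of stub S2″ `stub_proofsToACEquiv`, crux
`RestorationQP`). [folklore] -/
theorem proofsToACEquiv_aux_blockTreeLast : ∀ (n : ℕ) (G : Type) [Fintype G] (D : LabelledArithCircuit ℂ (Fin n × Fin n) Unit G) (g : G), ACStability.blockTree D g (ACStability.bl (G := G) - 1) = ACStability.binTree D g := by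
  intro n G _ D g
  exact ACStability.blockTree_last g

end Summit.ValiantsHypothesis.ValiantsHypothesis.Theorems

end
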